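import Literature.Analysis.FluidPDE.ElgindiRadialProfileMode
import HarnessLib

/-!
# The radial factor of the defect of the approximate stream function of `Φ_*`
([Elgindi2021] §8.3 Proposition 8.13; [ElgindiGhoulMasmoudi2021] §2.3.1)

Topic `Literature/Analysis/FluidPDE`. Support file (definitions with bodies and proved theorems, no
named facts) on the proof path of the named fact
`Literature.Analysis.FluidPDE.Elgindi.ElgindiGhoulMasmoudi2021_stabilityCore`
(`ElgindiStabilityDecomposition.lean`). T. M. Elgindi, Ann. of Math. 194 (2021) =
arXiv:1904.04795, §8.3 Proposition 8.13 (p. 27); Elgindi–Ghoul–Masmoudi, arXiv:1910.14071, §2.3.1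
(p. 9).

With `F_* = r(z)Γ(θ)`, `r = (4α/c)·r₀`, `r₀ = z/(1+z)²`, the approximate stream function
`Φ_app = a(z) sin 2θ + r(z)ψ₁(θ)` (`a` the radial mode of `ElgindiRadialProfileMode.lean`, `ψ₁` the
angular corrector) has `L_αΦ_app = F_* + (4α/c)·((L_z − μ₁)r₀)(z)·ψ₁(θ)`, because `(L_θ + μ₁)ψ₁ = Γ̄`
and `L_z z = μ₁z` makes `L_z − μ₁` **annihilate the leading term of `r₀` at `z = 0`**:

`(L_z − μ₁)r₀ = α·z²(6α + 10 + 10z)/(1+z)⁴ =: defectShape α`   (`Lz_sub_muOne_shapeR0`),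

of size `O(α)` (so the defect radial factor `(4α/c)·defectShape` is `O(α²)`), vanishing to second
order at `z = 0` and decaying like `1/z`. In the variable `u = 1/(1+z)` it is `α·u(1−u)²(10 + 6αu)`; the
class `u(1−u)²·ℝ[u]` is stable under `D_z` (`stepU (T R) = T (stepR R)`), whence the **word bounds**
`|D_z^j defectShape| ≤ C_j·α·z²/(1+z)³` on `z > 0`, uniformly in `0 < α ≤ 1` (`abs_iterate_Dz₁_defectShape_le`),
which make `w²(D_z^j·)²` integrable on `(0,∞)` (`w² = (1+z)⁴/z⁴`).
-/

noncomputable section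

open Set Real Filter Polynomial
open _root_.Topology
open scoped ContDiff

namespace Literature.Analysis.FluidPDE

namespace Elgindi

/-! ### `polyU` on `(0, ∞)` -/

/-- `polyU P ∈ C^∞(0,∞)`. [folklore] -/
theorem contDiffOn_polyU_Ioi (P : ℝ[X]) : ContDiffOn ℝ ∞ (polyU P) (Ioi 0) := by
  have hev : ContDiff ℝ ∞ (fun x : ℝ => P.eval x) := by
    have h := Polynomial.contDiff_aeval (𝕜 := ℝ) P ((⊤ : ℕ∞) : WithTop ℕ∞)
    simpa only [Polynomial.coe_aeval_eq_eval] using h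
  have hinv : ContDiffOn ℝ ∞ (fun z : ℝ => (1 + z)⁻¹) (Ioi 0) :=
    ContDiffOn.inv (by fun_prop) fun z hz => by simp only [mem_Ioi] at hz; positivity
  exact (hev.comp_contDiffOn hinv).congr fun z _ => rfl

/-- **`D_z^j (polyU P) = polyU (stepU^j P)`** on `z > 0`. [folklore] -/
theorem iterate_Dz₁_polyU (P : ℝ[X]) (j : ℕ) : ∀ z : ℝ, 0 < z → (Dz₁^[j] (polyU P)) z = polyU (stepU^[j] P) z := by
  induction j generalizing P with
  | zero => intro z _; rfl
  | succ j ih =>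
    intro z hz
    rw [Function.iterate_succ_apply, Function.iterate_succ_apply]
    have e1 : EqOn (Dz₁ (polyU P)) (polyU (stepU P)) (Ioi 0) := fun w hw => Dz₁_polyU _ (by simp only [mem_Ioi] at hw; linarith)
    rw [iterate_Dz₁_congr_Ioi e1 j hz]
    exact ih (stepU P) z hz

/-! ### The class `u(1−u)²·ℝ[u]` -/

/-- `T R = X(1−X)²·R`: polynomials in `u` giving functions `O(z²)` at `z = 0` and `O(1/z)` at `∞`. [folklore] -/
def shapeT (R : ℝ[X]) : ℝ[X] := X * (1 - X) ^ 2 * R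

/-- The induced `D_z`-step on `R`: `stepU (T R) = T (stepR R)`. [folklore] -/
def stepR (R : ℝ[X]) : ℝ[X] := -((1 - 3 * X) * R + X * (1 - X) * derivative R)

/-- **`stepU (T R) = T (stepR R)`**: the class `u(1−u)²ℝ[u]` is stable under `D_z`. [folklore] -/
theorem stepU_shapeT (R : ℝ[X]) : stepU (shapeT R) = shapeT (stepR R) := by
  simp only [stepU, shapeT, stepR, derivative_mul, derivative_X, derivative_pow, derivative_sub, derivative_one, derivative_X,
    map_ofNat, Nat.cast_ofNat]
  ring

/-- Iterated. [folklore] -/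
theorem iterate_stepU_shapeT (R : ℝ[X]) (j : ℕ) : stepU^[j] (shapeT R) = shapeT (stepR^[j] R) := by
  induction j generalizing R with
  | zero => rfl
  | succ j ih => rw [Function.iterate_succ_apply, Function.iterate_succ_apply, stepU_shapeT, ih]

/-- `(T R)(0) = 0`. [folklore] -/
theorem eval_zero_shapeT (R : ℝ[X]) : (shapeT R).eval 0 = 0 := by simp [shapeT]

/-- **`|polyU (T R) z| ≤ (Σ|coeff R|)·z²/(1+z)³`** on `z ≥ 0` (`u(1−u)² = z²/(1+z)³`). [folklore] -/
theorem abs_polyU_shapeT_le (R : ℝ[X]) {z : ℝ} (hz : 0 ≤ z) :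
    |polyU (shapeT R) z| ≤ (∑ i ∈ Finset.range (R.natDegree + 1), |R.coeff i|) * (z ^ 2 / (1 + z) ^ 3) := by
  have hz1 : 0 < 1 + z := by linarith
  set u : ℝ := (1 + z)⁻¹ with hu
  have hu0 : 0 ≤ u := by rw [hu]; positivity
  have hu1 : u ≤ 1 := by rw [hu]; exact inv_le_one_of_one_le₀ (by linarith)
  have hR : |R.eval u| ≤ ∑ i ∈ Finset.range (R.natDegree + 1), |R.coeff i| := by
    rw [Polynomial.eval_eq_sum_range]
    refine (Finset.abs_sum_le_sum_abs _ _).trans (Finset.sum_le_sum fun i _ => ?_)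
    rw [abs_mul, abs_of_nonneg (pow_nonneg hu0 _)]
    calc |R.coeff i| * u ^ i ≤ |R.coeff i| * 1 := mul_le_mul_of_nonneg_left (pow_le_one₀ hu0 hu1) (abs_nonneg _)
      _ = |R.coeff i| := mul_one _
  have e : z ^ 2 / (1 + z) ^ 3 = u * (1 - u) ^ 2 := by rw [hu]; field_simp; ring
  have hfac : 0 ≤ u * (1 - u) ^ 2 := by positivity
  simp only [polyU, shapeT, eval_mul, eval_X, eval_pow, eval_sub, eval_one, ← hu]
  rw [e, abs_mul, show |u * (1 - u) ^ 2| = u * (1 - u) ^ 2 from abs_of_nonneg hfac, mul_comm]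
  exact mul_le_mul_of_nonneg_right hR hfac

/-- **Word bounds in the class**: `|D_z^j polyU (T R)| ≤ C_j·z²/(1+z)³` on `z > 0`. [folklore] -/
theorem exists_abs_iterate_Dz₁_polyU_shapeT_le (R : ℝ[X]) (j : ℕ) :
    ∃ C : ℝ, 0 ≤ C ∧ ∀ z : ℝ, 0 < z → |(Dz₁^[j] (polyU (shapeT R))) z| ≤ C * (z ^ 2 / (1 + z) ^ 3) := by
  refine ⟨∑ i ∈ Finset.range ((stepR^[j] R).natDegree + 1), |(stepR^[j] R).coeff i|, Finset.sum_nonneg fun _ _ => abs_nonneg _,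
    fun z hz => ?_⟩
  rw [iterate_Dz₁_polyU _ j z hz, iterate_stepU_shapeT]
  exact abs_polyU_shapeT_le _ hz.le

/-! ### The defect shape `(L_z − μ₁)r₀` -/

/-- **`defectShape α z = α·z²(6α + 10 + 10z)/(1+z)⁴ = (L_z − μ₁)r₀`.** [cite: Elgindi2021, §8.3 Proposition 8.13 (p. 27 of arXiv:1904.04795): the structure of Φ_*] -/
def defectShape (α z : ℝ) : ℝ := α * (z ^ 2 * (6 * α + 10 + 10 * z) / (1 + z) ^ 4)

/-- The defect shape as a polynomial in `u`: `α·T(10 + 6αX)`. [folklore] -/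
def defectPoly (α : ℝ) : ℝ[X] := C α * shapeT (C 10 + C (6 * α) * X)

/-- `defectShape α = polyU (defectPoly α)` on `z > −1`. [folklore] -/
theorem defectShape_eq_polyU (α : ℝ) {z : ℝ} (hz : -1 < z) : defectShape α z = polyU (defectPoly α) z := by
  have hz1 : (1 + z) ≠ 0 := by linarith
  simp only [defectShape, polyU, defectPoly, shapeT, eval_mul, eval_C, eval_X, eval_pow, eval_sub, eval_one, eval_add]
  field_simp
  ring

/-- `D_z(z/(1+z)²) = z(1−z)/(1+z)³` on `z > 0`. [folklore] -/
theorem Dz₁_shapeR0_fun {z : ℝ} (hz : 0 < z) : Dz₁ (fun w : ℝ => w / (1 + w) ^ 2) z = z * (1 - z) / (1 + z) ^ 3 := by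
  have hz1 : (1 + z) ≠ 0 := by positivity
  have hd : HasDerivAt (fun w : ℝ => w / (1 + w) ^ 2) ((1 * (1 + z) ^ 2 - z * (((2:ℕ):ℝ) * (1 + z) ^ (2 - 1) * 1)) / ((1 + z) ^ 2) ^ 2) z :=
    (hasDerivAt_id' z).fun_div (((hasDerivAt_id' z).const_add 1).fun_pow 2) (pow_ne_zero 2 hz1)
  rw [Dz₁_apply, hd.deriv]
  push_cast
  field_simp
  ring

/-- `D_z²(z/(1+z)²) = z(1 − 4z + z²)/(1+z)⁴` on `z > 0`. [folklore] -/
theorem Dz₁_Dz₁_shapeR0_fun {z : ℝ} (hz : 0 < z) :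
    Dz₁ (Dz₁ fun w : ℝ => w / (1 + w) ^ 2) z = z * (1 - 4 * z + z ^ 2) / (1 + z) ^ 4 := by
  have hz1 : (1 + z) ≠ 0 := by positivity
  have heq : Dz₁ (fun w : ℝ => w / (1 + w) ^ 2) =ᶠ[𝓝 z] fun w => w * (1 - w) / (1 + w) ^ 3 := by
    filter_upwards [isOpen_Ioi.mem_nhds hz] with w hw using Dz₁_shapeR0_fun hw
  have hd : HasDerivAt (fun w : ℝ => w * (1 - w) / (1 + w) ^ 3)
      (((1 * (1 - z) + z * (-1)) * (1 + z) ^ 3 - z * (1 - z) * (((3:ℕ):ℝ) * (1 + z) ^ (3 - 1) * 1)) / ((1 + z) ^ 3) ^ 2) z :=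
    ((hasDerivAt_id' z).fun_mul ((hasDerivAt_id' z).const_sub 1)).fun_div (((hasDerivAt_id' z).const_add 1).fun_pow 3) (pow_ne_zero 3 hz1)
  rw [Dz₁_apply, heq.deriv_eq, hd.deriv]
  push_cast
  field_simp
  ring

/-- The `μ₁`-eigenfunction identity `L_z z = μ₁z` at work: **`−α²D_z²r₀ − 5αD_zr₀ + α(α+5)r₀ = defectShape α`**
on `z > 0` (`r₀ = z/(1+z)²`, `−μ₁ = α(α+5)`): `L_z − μ₁` annihilates the leading term `z` of `r₀`. [cite: Elgindi2021, §8.3 (p. 27 of arXiv:1904.04795)] -/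
theorem Lz_sub_muOne_shapeR0 (α : ℝ) {z : ℝ} (hz : 0 < z) :
    -α ^ 2 * Dz₁ (Dz₁ fun w : ℝ => w / (1 + w) ^ 2) z - 5 * α * Dz₁ (fun w : ℝ => w / (1 + w) ^ 2) z
      + α * (α + 5) * (z / (1 + z) ^ 2) = defectShape α z := by
  have hz1 : (1 + z) ≠ 0 := by positivity
  rw [Dz₁_Dz₁_shapeR0_fun hz, Dz₁_shapeR0_fun hz]
  unfold defectShape
  field_simp
  ring

/-- **`|D_z^j defectShape α| ≤ C_j·α·z²/(1+z)³`** on `z > 0`, uniformly in `0 ≤ α ≤ 1`. [folklore] -/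
theorem abs_iterate_Dz₁_defectShape_le (j : ℕ) :
    ∃ C : ℝ, 0 ≤ C ∧ ∀ α ∈ Icc (0:ℝ) 1, ∀ z : ℝ, 0 < z → |(Dz₁^[j] (defectShape α)) z| ≤ C * α * (z ^ 2 / (1 + z) ^ 3) := by
  obtain ⟨C₁, hC₁, h₁⟩ := exists_abs_iterate_Dz₁_polyU_shapeT_le (C 10 : ℝ[X]) j
  obtain ⟨C₂, hC₂, h₂⟩ := exists_abs_iterate_Dz₁_polyU_shapeT_le (X : ℝ[X]) j
  refine ⟨C₁ + 6 * C₂, by positivity, fun α hα z hz => ?_⟩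
  -- `defectShape α = α·(polyU (T 10) + 6α·polyU (T X))` on `(0,∞)`
  have hrep : EqOn (defectShape α) (fun w => α * (polyU (shapeT (C 10)) w + 6 * α * polyU (shapeT X) w)) (Ioi 0) := by
    intro w hw
    have hw1 : (1 + w) ≠ 0 := by simp only [mem_Ioi] at hw; positivity
    simp only [defectShape, polyU, shapeT, eval_mul, eval_C, eval_X, eval_pow, eval_sub, eval_one]
    field_simp
    ring
  have hT1 : ContDiffOn ℝ ∞ (polyU (shapeT (C 10 : ℝ[X]))) (Ioi 0) := contDiffOn_polyU_Ioi _
  have hT2 : ContDiffOn ℝ ∞ (polyU (shapeT (X : ℝ[X]))) (Ioi 0) := contDiffOn_polyU_Ioi _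
  rw [iterate_Dz₁_congr_Ioi hrep j hz]
  have e2 : (Dz₁^[j] fun w => α * (polyU (shapeT (C 10)) w + 6 * α * polyU (shapeT X) w)) z =
      α * ((Dz₁^[j] (polyU (shapeT (C 10)))) z + 6 * α * (Dz₁^[j] (polyU (shapeT X))) z) := by
    have hcm := congrFun (iterate_Dz₁_const_mul' α (fun w => polyU (shapeT (C 10)) w + 6 * α * polyU (shapeT X) w) j) z
    rw [hcm]
    congr 1
    rw [iterate_Dz₁_add_Ioi_infty hT1 (contDiffOn_const.mul hT2) j hz]
    congr 1
    have hcm2 := congrFun (iterate_Dz₁_const_mul' (6 * α) (fun w => polyU (shapeT X) w) j) z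
    exact hcm2
  rw [e2, abs_mul, abs_of_nonneg hα.1]
  have hb1 := h₁ z hz
  have hb2 := h₂ z hz
  have hq : 0 ≤ z ^ 2 / (1 + z) ^ 3 := by positivity
  calc α * |(Dz₁^[j] (polyU (shapeT (C 10)))) z + 6 * α * (Dz₁^[j] (polyU (shapeT X))) z|
      ≤ α * (C₁ * (z ^ 2 / (1 + z) ^ 3) + 6 * α * (C₂ * (z ^ 2 / (1 + z) ^ 3))) := by
        refine mul_le_mul_of_nonneg_left ((abs_add_le _ _).trans (add_le_add hb1 ?_)) hα.1
        rw [abs_mul, abs_of_nonneg (by linarith [hα.1] : (0:ℝ) ≤ 6 * α)]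
        exact mul_le_mul_of_nonneg_left hb2 (by linarith [hα.1])
    _ ≤ (C₁ + 6 * C₂) * α * (z ^ 2 / (1 + z) ^ 3) := by nlinarith [hα.1, hα.2, mul_nonneg hC₂ hq, mul_nonneg hα.1 (mul_nonneg hC₂ hq)]

/-- `defectShape α ∈ C^∞(0, ∞)`. [folklore] -/
theorem contDiffOn_defectShape (α : ℝ) : ContDiffOn ℝ ∞ (defectShape α) (Ioi 0) :=
  (contDiffOn_polyU_Ioi (defectPoly α)).congr fun z hz => defectShape_eq_polyU α (by simp only [mem_Ioi] at hz; linarith)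

end Elgindi

end Literature.Analysis.FluidPDE
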